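import Mathlib
import Summits.QuantumFields.BalabanUV.T4Continuum.Support.SpaceTimeAnimals

/-!
# Counting connected vertex sets through a vertex — line «sfm-bl» (PROOF-SFM-BL Lemma 5)

FRONTIER F-N1c; nothing here bears on P vs NP.

In a finite simple graph all of whose degrees are `≤ L`, the connected induced vertex sets of size `n + 1`
containing a fixed vertex `v` number at most `L ^ (2 n)`; hence at most `|V| · L ^ (2 n)` in total.
(Print form: `(eL)^{n}`, Bilu–Linial 2006 p. 505 «n·d^k»; any bound `(cL^a)^n` serves the sfm-bl union bounds,
which carry a factor `L^{-12(n+1)}`.)  The proof is the closed-walk encoding already kernel-checked in the tree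
(`Summit.QuantumFields.BalabanUV.T4Continuum.SpaceTimePeierls.exists_covering_walk`: a connected `S ∋ v` is the
support of a closed walk at `v` of length `2(#S − 1)`; there are `≤ L^ℓ` vertex lists of walks of length `ℓ`).
[folklore]
-/

namespace Summit.PneNP.PneNP.Theorems.SfmBl

open Finset SimpleGraph
open Summit.QuantumFields.BalabanUV.T4Continuum.SpaceTimePeierls

variable {V : Type} [Fintype V] [DecidableEq V] (G : SimpleGraph V) [DecidableRel G.Adj]

/-- CONNECTED SETS THROUGH A VERTEX (ℕ-form): with all degrees `≤ L`, the vertex sets `S ∋ v` of size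
`n + 1` whose induced subgraph is connected number at most `L ^ (2 n)`. [folklore] -/
theorem card_connectedThrough_le {L : ℕ} (hdeg : ∀ u, G.degree u ≤ L) (v : V) (n : ℕ) :
    Nat.card {S : Finset V // v ∈ S ∧ S.card = n + 1 ∧ (G.induce (S : Set V)).Connected} ≤ L ^ (2 * n) := by
  classical
  rw [Nat.card_eq_fintype_card]
  let f : {S : Finset V // v ∈ S ∧ S.card = n + 1 ∧ (G.induce (S : Set V)).Connected} →
      ((chains G (2 * n) v).image List.toFinset) := fun S =>
    ⟨S.1, by
      obtain ⟨hvS, hc, hconn⟩ := S.2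
      obtain ⟨p, hlen, hsupp⟩ := exists_covering_walk G (n + 1) S.1 hc hconn hvS
      have hl : p.length = 2 * n := by omega
      have hmem : p.support ∈ chains G (2 * n) v := by rw [← hl]; exact support_mem_chains G p
      exact mem_image.2 ⟨p.support, hmem, hsupp⟩⟩
  have hf : Function.Injective f := by
    intro a b h
    apply Subtype.ext
    have h' := congrArg Subtype.val h
    exact h'
  calc Fintype.card {S : Finset V // v ∈ S ∧ S.card = n + 1 ∧ (G.induce (S : Set V)).Connected}
      ≤ Fintype.card ((chains G (2 * n) v).image List.toFinset) := Fintype.card_le_of_injective f hf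
    _ = ((chains G (2 * n) v).image List.toFinset).card := Fintype.card_coe _
    _ ≤ (chains G (2 * n) v).card := card_image_le
    _ ≤ L ^ (2 * n) := card_chains_le G hdeg (2 * n) v


/-- ALL CONNECTED SETS OF A GIVEN SIZE (ℕ-form): with all degrees `≤ L`, the vertex sets of size `n + 1` whose
induced subgraph is connected number at most `|V| · L ^ (2 n)` (anchor each set at one of its vertices). [folklore] -/
theorem card_connectedSets_le {L : ℕ} (hdeg : ∀ u, G.degree u ≤ L) (n : ℕ) :
    Nat.card {S : Finset V // S.card = n + 1 ∧ (G.induce (S : Set V)).Connected}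
      ≤ Fintype.card V * L ^ (2 * n) := by
  classical
  rw [Nat.card_eq_fintype_card]
  -- anchor: a set of size `n + 1` is nonempty; send it to (its minimal-index vertex, itself)
  let T := Σ v : V, {S : Finset V // v ∈ S ∧ S.card = n + 1 ∧ (G.induce (S : Set V)).Connected}
  have hne : ∀ S : {S : Finset V // S.card = n + 1 ∧ (G.induce (S : Set V)).Connected}, S.1.Nonempty :=
    fun S => card_pos.1 (by rw [S.2.1]; exact Nat.succ_pos n)
  let g : {S : Finset V // S.card = n + 1 ∧ (G.induce (S : Set V)).Connected} → T := fun S =>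
    ⟨(hne S).choose, ⟨S.1, (hne S).choose_spec, S.2.1, S.2.2⟩⟩
  have hg : Function.Injective g := by
    intro a b h
    have h2 : (g a).2.1 = a.1 := rfl
    have h3 : (g b).2.1 = b.1 := rfl
    apply Subtype.ext
    rw [← h2, ← h3, h]
  calc Fintype.card {S : Finset V // S.card = n + 1 ∧ (G.induce (S : Set V)).Connected}
      ≤ Fintype.card T := Fintype.card_le_of_injective g hg
    _ = ∑ v : V, Fintype.card {S : Finset V // v ∈ S ∧ S.card = n + 1 ∧ (G.induce (S : Set V)).Connected} :=
        Fintype.card_sigma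
    _ ≤ ∑ _v : V, L ^ (2 * n) := by
        refine sum_le_sum fun v _ => ?_
        have h := card_connectedThrough_le G hdeg v n
        rwa [Nat.card_eq_fintype_card] at h
    _ = Fintype.card V * L ^ (2 * n) := by rw [sum_const, smul_eq_mul, card_univ]

/-- Real-valued form for union bounds: the number of connected `(n+1)`-sets through `v` is `≤ (L²)^n`. [folklore] -/
theorem card_connectedThrough_le_real {L : ℕ} (hdeg : ∀ u, G.degree u ≤ L) (v : V) (n : ℕ) :
    (Nat.card {S : Finset V // v ∈ S ∧ S.card = n + 1 ∧ (G.induce (S : Set V)).Connected} : ℝ)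
      ≤ ((L : ℝ) ^ 2) ^ n := by
  have h := card_connectedThrough_le G hdeg v n
  have h' : ((Nat.card {S : Finset V // v ∈ S ∧ S.card = n + 1 ∧ (G.induce (S : Set V)).Connected} : ℕ) : ℝ)
      ≤ ((L ^ (2 * n) : ℕ) : ℝ) := by exact_mod_cast h
  simpa [pow_mul] using h'

/-- Real-valued form for union bounds: the number of connected `(n+1)`-sets is `≤ |V| · (L²)^n`. [folklore] -/
theorem card_connectedSets_le_real {L : ℕ} (hdeg : ∀ u, G.degree u ≤ L) (n : ℕ) :
    (Nat.card {S : Finset V // S.card = n + 1 ∧ (G.induce (S : Set V)).Connected} : ℝ)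
      ≤ (Fintype.card V : ℝ) * ((L : ℝ) ^ 2) ^ n := by
  have h := card_connectedSets_le G hdeg n
  have h' : ((Nat.card {S : Finset V // S.card = n + 1 ∧ (G.induce (S : Set V)).Connected} : ℕ) : ℝ)
      ≤ ((Fintype.card V * L ^ (2 * n) : ℕ) : ℝ) := by exact_mod_cast h
  simpa [pow_mul] using h'

end Summit.PneNP.PneNP.Theorems.SfmBl
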